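import Summits.CriticalPhenomena.PercolationContinuityZ3.Theorems.PercNearOneGluingNoHeavyLowerTailKnQuestion8CoefficientwiseCoreClassKernelMixBouquetLevels
import Summits.CriticalPhenomena.PercolationContinuityZ3.Theorems.PercNearOneGluingNoHeavyLowerTailKnQuestion8CoefficientwiseCoreClassKernelMixThreadWordsSmall

/-!
# The bouquet model of a bundle (L5 link, part 3): colourings of `Θ(ℓ₀, …, ℓ_{r−1})` ≅ a bouquet H-space, exact levels are levels

Support file (`--supports stmt-CriticalPhenomena-4575`, closed), prover `prim-cplus-coupling` (gen 67).  No definitions, no notations, no named facts, no sorries;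
standard axioms.  Memo `prim-cplus-coupling/A5-COUPLING-gen66.md` §7.2 (i)–(ii) and `A5-COUPLING-gen67.md` §1.

THEOREM `bouquet_model`.  For the thread data of an explicit bundle (`r` threads, thread `t` with edge labels `e t 1, …, e t (L t)`, pairwise distinct, edge sets `A t`
pairwise disjoint, vertices `w t j`) and every `m ≤ r` there are a bouquet H-space `H : Bouquet.HBundle` (glued from `HBundle.unit` by one `consLoop` / `consDigon` /
`consCycle (Fin (n+1))` per thread `t < m` according to `L t = 1, 2, n + 3`), a map `Ψ` from colourings to `H.X` and a cluster map `Y : H.X → Set V` such that,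
with `E_m = ⋃_{t<m} A t`:  `Ψ` only sees `σ ∩ E_m` and is an ORDER ISOMORPHISM from the colourings of `E_m` onto `H.X` (`Ψ σ ≤ Ψ σ' ↔ σ ∩ E_m ⊆ σ' ∩ E_m`, onto);
it intertwines complementation in `E_m` with the mirror `H.c`; `Ψ σ ∈ H.NF` iff no thread `t < m` is fully red; `(H, Y)` GENERATES LEVELS (`BouquetLevels.GenLevels`);
and `Y (Ψ σ) = {u, b} ∪ ⋃_{t<m} bRun_t(σ)` (the blue-run sets of `ThreadWords`).  With `ThreadWords.bundle_cluster_eq_runs` the last item identifies `Y ∘ Ψ` with the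
blue cluster `C_u(E ∖ σ)` whenever some thread is fully blue — so the EXACT LEVELS `{σ : no red thread, C_u(E∖σ) ∈ 𝒟}` of the bundle reduction are levels of `H`, and
`Bouquet.HBundle.x2` (the two-type theorem) applies to them.  The existential packaging avoids a carrier type depending on the values `L t`; the thread-independent
bookkeeping of one gluing step is `pair_model`.
[cite: KozmaNitzan2024, Questions 8–9 (§5.5 p. 36) (context); Harris 1960; Kleitman 1966]
-/

namespace Summit.CriticalPhenomena.PercolationContinuityZ3.Theorems.Coefficientwise.BouquetModel

open Finset HSpace CycleWords CycleFactor SmallCycles ReducedKleitman Bouquet BouquetLevels ThreadWords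

variable {ι V : Type*}

open Classical in
/-- `⋃_{t < m+1} A t = (⋃_{t<m} A t) ∪ A m`, membership form. -/
theorem mem_biUnion_range_succ (A : ℕ → Finset ι) (m : ℕ) (i : ι) :
    i ∈ (range (m + 1)).biUnion A ↔ i ∈ (range m).biUnion A ∨ i ∈ A m := by
  simp only [mem_biUnion, mem_range]
  constructor
  · rintro ⟨t, ht, hi⟩
    rcases Nat.lt_succ_iff_lt_or_eq.mp ht with ht | rfl
    · exact Or.inl ⟨t, ht, hi⟩
    · exact Or.inr hi
  · rintro (⟨t, ht, hi⟩ | hi)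
    · exact ⟨t, Nat.lt_succ_of_lt ht, hi⟩
    · exact ⟨m, Nat.lt_succ_self m, hi⟩

open Classical in
/-- Membership in `⋃_{t<m} A t`. -/
theorem mem_biUnion_range (A : ℕ → Finset ι) (m : ℕ) (i : ι) : i ∈ (range m).biUnion A ↔ ∃ t, t < m ∧ i ∈ A t := by
  simp [mem_biUnion, mem_range]

open Classical in
/-- **One gluing step, thread-independent bookkeeping.**  If `Ψ` models the colourings of `F` in `H` (sees only `σ ∩ F`, order isomorphism onto `H.X`, mirror,
`NF ↔ P`) and `wd` is a word map of a new thread with edge set `At` disjoint from `F` (congruence, order embedding, onto `W`, complement ↦ `cW`, `NFW ↔` not fully red),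
then the PAIR map `σ ↦ (Ψ σ, wd σ)` models the colourings of `G = F ∪ At` in `H.X × W` with witness region `H.NF ×ˢ NFW`. -/
theorem pair_model {W : Type} [Preorder W] (H : HBundle) (Ψ : Finset ι → H.X) (F At G : Finset ι)
    (hFG : ∀ i, i ∈ G ↔ i ∈ F ∨ i ∈ At) (hdisj : ∀ i, i ∈ At → i ∉ F)
    (ℓ : ℕ) (ed : ℕ → ι) (hAt : ∀ i, i ∈ At ↔ ∃ j, 1 ≤ j ∧ j ≤ ℓ ∧ ed j = i)
    (hΨE : ∀ σ, Ψ σ = Ψ (σ ∩ F)) (hord : ∀ σ σ', Ψ σ ≤ Ψ σ' ↔ σ ∩ F ⊆ σ' ∩ F)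
    (hsurj : ∀ x, ∃ σ, σ ⊆ F ∧ Ψ σ = x) (hmir : ∀ σ, H.c (Ψ σ) = Ψ (F \ σ))
    (P : Finset ι → Prop) (hNF : ∀ σ, Ψ σ ∈ H.NF ↔ P σ)
    (wd : Finset ι → W) (cW : W → W) (NFW : Finset W)
    (wd_congr : ∀ σ σ', (∀ j, 1 ≤ j → j ≤ ℓ → (ed j ∈ σ ↔ ed j ∈ σ')) → wd σ = wd σ')
    (wd_le : ∀ σ σ', wd σ ≤ wd σ' ↔ ∀ j, 1 ≤ j → j ≤ ℓ → ed j ∈ σ → ed j ∈ σ')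
    (wd_surj : ∀ v, ∃ ρ, ρ ⊆ At ∧ wd ρ = v)
    (wd_sdiff : ∀ F' σ, (∀ j, 1 ≤ j → j ≤ ℓ → ed j ∈ F') → wd (F' \ σ) = cW (wd σ))
    (wd_nf : ∀ σ, wd σ ∈ NFW ↔ ¬ ∀ j, 1 ≤ j → j ≤ ℓ → ed j ∈ σ) :
    (∀ σ, (Ψ σ, wd σ) = (Ψ (σ ∩ G), wd (σ ∩ G))) ∧
    (∀ σ σ', (Ψ σ, wd σ) ≤ (Ψ σ', wd σ') ↔ σ ∩ G ⊆ σ' ∩ G) ∧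
    (∀ (x : H.X) (v : W), ∃ σ, σ ⊆ G ∧ (Ψ σ, wd σ) = (x, v)) ∧
    (∀ σ, (H.c (Ψ σ), cW (wd σ)) = (Ψ (G \ σ), wd (G \ σ))) ∧
    (∀ σ, (Ψ σ, wd σ) ∈ H.NF ×ˢ NFW ↔ P σ ∧ ¬ At ⊆ σ) := by
  have hFG' : F ⊆ G := fun i hi => (hFG i).mpr (Or.inl hi)
  have heA : ∀ j, 1 ≤ j → j ≤ ℓ → ed j ∈ At := fun j h1 h2 => (hAt _).mpr ⟨j, h1, h2, rfl⟩
  have heG : ∀ j, 1 ≤ j → j ≤ ℓ → ed j ∈ G := fun j h1 h2 => (hFG _).mpr (Or.inr (heA j h1 h2))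
  have heF : ∀ j, 1 ≤ j → j ≤ ℓ → ed j ∉ F := fun j h1 h2 => hdisj _ (heA j h1 h2)
  have hAtσ : ∀ σ : Finset ι, At ⊆ σ ↔ ∀ j, 1 ≤ j → j ≤ ℓ → ed j ∈ σ := fun σ =>
    ⟨fun h j h1 h2 => h (heA j h1 h2), fun h x hx => by obtain ⟨j, h1, h2, rfl⟩ := (hAt x).mp hx; exact h j h1 h2⟩
  have s1 : ∀ σ : Finset ι, (σ ∩ G) ∩ F = σ ∩ F := by
    intro σ; rw [inter_assoc, inter_eq_right.mpr hFG']
  have s2 : ∀ σ : Finset ι, (G \ σ) ∩ F = (F \ σ) ∩ F := by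
    intro σ; ext x
    simp only [mem_inter, mem_sdiff]
    exact ⟨fun h => ⟨⟨h.2, h.1.2⟩, h.2⟩, fun h => ⟨⟨hFG' h.2, h.1.2⟩, h.2⟩⟩
  have hΨG : ∀ σ, Ψ (σ ∩ G) = Ψ σ := by
    intro σ; rw [hΨE (σ ∩ G), s1, ← hΨE]
  have hΨsdiff : ∀ σ, Ψ (G \ σ) = Ψ (F \ σ) := by
    intro σ; rw [hΨE (G \ σ), s2, ← hΨE]
  refine ⟨?_, ?_, ?_, ?_, ?_⟩
  · -- sees only σ ∩ G
    intro σ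
    rw [Prod.mk.injEq]
    exact ⟨(hΨG σ).symm, wd_congr _ _ fun j h1 h2 => ⟨fun h => mem_inter.mpr ⟨h, heG j h1 h2⟩, fun h => (mem_inter.mp h).1⟩⟩
  · -- order
    intro σ σ'
    rw [Prod.mk_le_mk, hord, wd_le]
    constructor
    · rintro ⟨h, hj⟩ x hx
      obtain ⟨hxσ, hxG⟩ := mem_inter.mp hx
      refine mem_inter.mpr ⟨?_, hxG⟩
      rcases (hFG x).mp hxG with hxF | hxA
      · exact (mem_inter.mp (h (mem_inter.mpr ⟨hxσ, hxF⟩))).1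
      · obtain ⟨j, h1, h2, rfl⟩ := (hAt x).mp hxA
        exact hj j h1 h2 hxσ
    · intro h
      refine ⟨fun x hx => ?_, fun j h1 h2 hj => ?_⟩
      · obtain ⟨hxσ, hxF⟩ := mem_inter.mp hx
        exact mem_inter.mpr ⟨(mem_inter.mp (h (mem_inter.mpr ⟨hxσ, hFG' hxF⟩))).1, hxF⟩
      · exact (mem_inter.mp (h (mem_inter.mpr ⟨hj, heG j h1 h2⟩))).1
  · -- onto
    intro x v
    obtain ⟨σ₀, h0, hx⟩ := hsurj x
    obtain ⟨ρ, hρ, hv⟩ := wd_surj v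
    refine ⟨σ₀ ∪ ρ, fun i hi => ?_, ?_⟩
    · rcases mem_union.mp hi with hi | hi
      · exact hFG' (h0 hi)
      · exact (hFG i).mpr (Or.inr (hρ hi))
    · have hint : (σ₀ ∪ ρ) ∩ F = σ₀ ∩ F := by
        ext y; simp only [mem_inter, mem_union]
        exact ⟨fun h => ⟨h.1.elim id (fun hy => absurd h.2 (hdisj y (hρ hy))), h.2⟩, fun h => ⟨Or.inl h.1, h.2⟩⟩
      rw [Prod.mk.injEq]
      refine ⟨by rw [hΨE, hint, ← hΨE, hx], ?_⟩
      rw [← hv]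
      refine wd_congr _ _ fun j h1 h2 => ?_
      rw [mem_union]
      exact ⟨fun h => h.elim (fun h' => absurd (h0 h') (heF j h1 h2)) id, fun h => Or.inr h⟩
  · -- mirror
    intro σ
    rw [Prod.mk.injEq, hmir, hΨsdiff, wd_sdiff G σ heG]
    exact ⟨rfl, rfl⟩
  · -- witness region
    intro σ
    rw [mem_product, hNF, wd_nf, hAtσ]

open Classical in
/-- **The bouquet model of the first `m` threads of a bundle.**  See the module docstring. -/
theorem bouquet_model (r : ℕ) (L : ℕ → ℕ) (hL : ∀ t, t < r → 1 ≤ L t) (w : ℕ → ℕ → V) (e : ℕ → ℕ → ι) (u b : V)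
    (heinj : ∀ t, t < r → ∀ i j, 1 ≤ i → i ≤ L t → 1 ≤ j → j ≤ L t → e t i = e t j → i = j)
    (A : ℕ → Finset ι) (hA : ∀ t, t < r → ∀ i, i ∈ A t ↔ ∃ j, 1 ≤ j ∧ j ≤ L t ∧ e t j = i)
    (hAdisj : ∀ t t', t < r → t' < r → t ≠ t' → Disjoint (A t) (A t'))
    (m : ℕ) (hm : m ≤ r) :
    ∃ (H : HBundle) (Ψ : Finset ι → H.X) (Y : H.X → Set V),
      (∀ σ, Ψ σ = Ψ (σ ∩ (range m).biUnion A)) ∧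
      (∀ σ σ', Ψ σ ≤ Ψ σ' ↔ σ ∩ (range m).biUnion A ⊆ σ' ∩ (range m).biUnion A) ∧
      (∀ x : H.X, ∃ σ, σ ⊆ (range m).biUnion A ∧ Ψ σ = x) ∧
      (∀ σ, H.c (Ψ σ) = Ψ ((range m).biUnion A \ σ)) ∧
      (∀ σ, Ψ σ ∈ H.NF ↔ ∀ t, t < m → ¬ A t ⊆ σ) ∧
      GenLevels H Y ∧
      (∀ σ, Y (Ψ σ) = {x | x = u ∨ x = b ∨ ∃ t, t < m ∧ x ∈ bRun (L t) (w t) (e t) σ}) := by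
  induction m with
  | zero =>
    refine ⟨HBundle.unit, fun _ => (), fun _ => {x | x = u ∨ x = b}, fun _ => rfl, ?_, ?_, fun _ => rfl, ?_, genLevels_unit _, ?_⟩
    · intro σ σ'; simp
    · intro x; exact ⟨∅, empty_subset _, rfl⟩
    · intro σ
      show () ∈ ({()} : Finset Unit) ↔ _
      simp
    · intro σ; ext x; simp
  | succ m ih =>
    obtain ⟨H, Ψ, Y, hΨE, hord, hsurj, hmir, hNF, hgen, hY⟩ := ih (Nat.le_of_succ_le hm)
    have hmr : m < r := hm
    have hFG : ∀ i, i ∈ (range (m + 1)).biUnion A ↔ i ∈ (range m).biUnion A ∨ i ∈ A m := mem_biUnion_range_succ A m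
    have hAF : ∀ i, i ∈ A m → i ∉ (range m).biUnion A := by
      intro i hi hF
      obtain ⟨t, ht, hit⟩ := (mem_biUnion_range A m i).mp hF
      exact disjoint_left.mp (hAdisj t m (lt_trans ht hmr) hmr (ne_of_lt ht)) hit hi
    have hed : ∀ i j, 1 ≤ i → i ≤ L m → 1 ≤ j → j ≤ L m → e m i = e m j → i = j := heinj m hmr
    have hAm : ∀ i, i ∈ A m ↔ ∃ j, 1 ≤ j ∧ j ≤ L m ∧ e m j = i := hA m hmr
    -- no red thread among the first m+1
    have hnf : ∀ σ : Finset ι, ((∀ t, t < m → ¬ A t ⊆ σ) ∧ ¬ A m ⊆ σ) ↔ ∀ t, t < m + 1 → ¬ A t ⊆ σ := by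
      intro σ
      constructor
      · rintro ⟨h, hm'⟩ t ht
        rcases Nat.lt_succ_iff_lt_or_eq.mp ht with ht | rfl
        · exact h t ht
        · exact hm'
      · intro h; exact ⟨fun t ht => h t (Nat.lt_succ_of_lt ht), h m (Nat.lt_succ_self m)⟩
    -- the blue-run union
    have hruns : ∀ σ : Finset ι, ({x | x = u ∨ x = b ∨ ∃ t, t < m ∧ x ∈ bRun (L t) (w t) (e t) σ} : Set V) ∪ bRun (L m) (w m) (e m) σ =
        {x | x = u ∨ x = b ∨ ∃ t, t < m + 1 ∧ x ∈ bRun (L t) (w t) (e t) σ} := by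
      intro σ; ext x
      simp only [Set.mem_union, Set.mem_setOf_eq]
      constructor
      · rintro ((h | h | ⟨t, ht, hx⟩) | h)
        · exact Or.inl h
        · exact Or.inr (Or.inl h)
        · exact Or.inr (Or.inr ⟨t, Nat.lt_succ_of_lt ht, hx⟩)
        · exact Or.inr (Or.inr ⟨m, Nat.lt_succ_self m, h⟩)
      · rintro (h | h | ⟨t, ht, hx⟩)
        · exact Or.inl (Or.inl h)
        · exact Or.inl (Or.inr (Or.inl h))
        · rcases Nat.lt_succ_iff_lt_or_eq.mp ht with ht | rfl
          · exact Or.inl (Or.inr (Or.inr ⟨t, ht, hx⟩))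
          · exact Or.inr hx
    have hLm : 1 ≤ L m := hL m hmr
    -- ## case split on the length of thread m
    rcases Nat.lt_or_ge (L m) 3 with hsmall | hbig
    · rcases (show L m = 1 ∨ L m = 2 by omega) with h1 | h2
      · -- ### loop (unit thread)
        have hAm1 : ∀ i, i ∈ A m ↔ ∃ j, 1 ≤ j ∧ j ≤ 1 ∧ e m j = i := by intro i; rw [hAm, h1]
        obtain ⟨P1, P2, P3, P4, P5⟩ := pair_model (W := Bool) H Ψ ((range m).biUnion A) (A m) ((range (m + 1)).biUnion A) hFG hAF
          1 (e m) hAm1 hΨE hord hsurj hmir _ hNF (wordL (e m)) (fun a => !a) {false}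
          (fun σ σ' h => wordL_congr (e m) (h 1 le_rfl le_rfl))
          (fun σ σ' => by
            rw [wordL_le_iff]
            exact ⟨fun h j h1' h2' => by obtain rfl : j = 1 := le_antisymm h2' h1'; exact h, fun h => h 1 le_rfl le_rfl⟩)
          (wordL_surj (e m) (A m) ((hAm1 _).mpr ⟨1, le_rfl, le_rfl, rfl⟩))
          (fun F' σ h => wordL_sdiff (e m) F' σ (h 1 le_rfl le_rfl))
          (fun σ => by
            rw [mem_singleton, ← Bool.not_eq_true, wordL_eq_true_iff]
            exact ⟨fun h hall => h (hall 1 le_rfl le_rfl), fun h h1' => h fun j hj1 hj2 => by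
              obtain rfl : j = 1 := le_antisymm hj2 hj1; exact h1'⟩)
        refine ⟨H.consLoop, fun σ => (Ψ σ, wordL (e m) σ), fun z => Y z.1 ∪ (fun _ : Bool => (∅ : Set V)) z.2,
          P1, P2, fun z => P3 z.1 z.2, P4, fun σ => (P5 σ).trans (hnf σ), genLevels_consLoop H Y hgen (fun _ : Bool => (∅ : Set V)), fun σ => ?_⟩
        show Y (Ψ σ) ∪ ∅ = _
        rw [hY, ← hruns σ, h1, bRun_one]
      · -- ### digon
        have hAm2 : ∀ i, i ∈ A m ↔ ∃ j, 1 ≤ j ∧ j ≤ 2 ∧ e m j = i := by intro i; rw [hAm, h2]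
        obtain ⟨P1, P2, P3, P4, P5⟩ := pair_model (W := Bool × Bool) H Ψ ((range m).biUnion A) (A m) ((range (m + 1)).biUnion A) hFG hAF
          2 (e m) hAm2 hΨE hord hsurj hmir _ hNF (wordD (e m)) (fun v => (!v.1, !v.2)) (univ.erase (true, true))
          (fun σ σ' h => wordD_congr (e m) h) (wordD_le_iff (e m))
          (wordD_surj (e m) (fun i j hi1 hi2 hj1 hj2 => hed i j hi1 (by omega) hj1 (by omega)) (A m) hAm2)
          (fun F' σ h => wordD_sdiff (e m) F' σ h)
          (fun σ => by rw [mem_erase, and_iff_left (mem_univ _), Ne, wordD_eq_top_iff])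
        refine ⟨H.consDigon, fun σ => (Ψ σ, wordD (e m) σ), fun z => Y z.1 ∪ YtD (w m) z.2,
          P1, P2, fun z => P3 z.1 z.2, P4, fun σ => (P5 σ).trans (hnf σ),
          genLevels_consDigon H Y hgen (YtD (w m)) (fun w₁ w₂ hw => ytD_off_top (w m) w₁ w₂ hw), fun σ => ?_⟩
        show Y (Ψ σ) ∪ YtD (w m) (wordD (e m) σ) = _
        rw [hY, ytD_wordD, ← hruns σ, h2]
    · -- ### cycle of length n + 3
      obtain ⟨n, hn⟩ : ∃ n, L m = n + 3 := ⟨L m - 3, by omega⟩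
      have hAm3 : ∀ i, i ∈ A m ↔ ∃ j, 1 ≤ j ∧ j ≤ n + 3 ∧ e m j = i := by intro i; rw [hAm, hn]
      obtain ⟨P1, P2, P3, P4, P5⟩ := pair_model (W := Bool × Finset (Fin (n + 1)) × Bool) H Ψ ((range m).biUnion A) (A m)
        ((range (m + 1)).biUnion A) hFG hAF (n + 3) (e m) hAm3 hΨE hord hsurj hmir _ hNF (wordC n (e m)) cw (univ.erase (topW (Fin (n + 1))))
        (fun σ σ' h => wordC_congr n (e m) h) (wordC_le_iff n (e m))
        (wordC_surj n (e m) (fun i j hi1 hi2 hj1 hj2 => hed i j hi1 (by omega) hj1 (by omega)) (A m) hAm3)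
        (wordC_sdiff n (e m))
        (fun σ => by rw [mem_erase, and_iff_left (mem_univ _), Ne, wordC_eq_top_iff])
      refine ⟨H.consCycle (Fin (n + 1)), fun σ => (Ψ σ, wordC n (e m) σ), fun z => Y z.1 ∪ YtC n (w m) z.2,
        P1, P2, fun z => P3 z.1 z.2, P4, fun σ => (P5 σ).trans (hnf σ),
        genLevels_consCycle (Fin (n + 1)) H Y hgen (YtC n (w m)) (fun _ _ hle => ytC_anti n (w m) hle) (ytC_RB n (w m)) (ytC_BR n (w m))
          (fun μ w' => by rw [ytC_RR]; exact Set.empty_subset _), fun σ => ?_⟩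
      show Y (Ψ σ) ∪ YtC n (w m) (wordC n (e m) σ) = _
      rw [hY, ytC_wordC, ← hruns σ, hn]

end Summit.CriticalPhenomena.PercolationContinuityZ3.Theorems.Coefficientwise.BouquetModel
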